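import Summits.QuantumAdvantage.AdviceFreeQNC0.PairReaders
import Summits.QuantumAdvantage.AdviceFreeQNC0.SparseOfGap
import Summits.QuantumAdvantage.AdviceFreeQNC0.EliminationHardnessF
import Mathlib.Analysis.SpecificLimits.Normed
import HarnessLib

/-!
# Rung R8 `WalkHardFFewReaders p`: a pair with few far readers forces a constant loss (every prime `p ≠ 3`)

Planner qa-qnc0-p2 g15, ROUND-15 (p2) §3.6 / `line15/Sketch15R7.lean` (def VERBATIM below; = stub `stub_fewReadersOdd` of the
crux `DenseResidualSqrtOdd`, stmt-QuantumAdvantage-23029, at `p ≥ 5`): a strategy `y` of `𝔽_p`-degree `(log₂ n)^C` for α's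
u-walk game `ringWinU c y` in which SOME adjacent bit pair `(u_a, u_{a+1})` is read only by the cuts within distance
`w ≤ (log₂ n)^C` and by an exceptional set `S` of at most `(log₂ n)^C` far cuts wins on at most `θ·2ⁿ` inputs,
`θ = 1 − η₀(p)/4 < 1`.  R7 (`WalkHardFPairLocal`, qn-prover g10) is the case `S = ∅`; every `(log₂ n)^C`-junta strategy and
every `w`-local strategy is inside.

PROOF.  Special cuts `T := S ∪ {near cuts}` (`|T| ≤ 3(log₂ n)^C + 3`); g8's `CutFreeInterval.exists_free_interval` gives a bit
block `E = [i, i+L)`, `(|T|+1)·L ≥ n`, with no special cut strictly inside (hence `E` avoids the pair).  Fix a background `x`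
and vary the block bits `z`; the three representatives are `u_t = ow i L (setPair a t x) z`.  By the three-speed parity identity
of `PairReaders.lean`, `Σ_t winCount(u_t) ≡ Q_{|z| mod 3}(x,z) (mod 2)` and a losing residue `ω♭(x,z)` (with `Q_{ω♭}` even)
exists, whose level sets have `𝔽_p`-degree `≤ 3|T|(log₂ n)^C ≤ c₀√L`; level-set elimination on the `L`-cube
(`elimLevelSqrtF`, the hypothesis shape `hE` below) gives `ω♭ = |z| mod 3` — hence a LOSING representative — for `≥ η₀·2^L`
block fillings of every background; g8's fibre double count `GapFibre.sum_fibre` turns this into `≥ η₀·2ⁿ` inputs whose pair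
fibre contains a loser, and the map "input ↦ its losing representative" is at most `4`-to-`1`: losses `≥ (η₀/4)·2ⁿ`.
Main results: `FewReaders.card_win_le` (one `n`, explicit hypotheses), `walkHardFFewReaders_of_elimLevel` (every prime, from
the `elimLevelSqrtF`-shape hypothesis) and `walkHardFFewReaders (p) (hp3 : p ≠ 3)`.
WHAT THIS IS NOT: the residual `ManyReadersSqrtOdd` (every pair has more than polylog far readers — high fan-in counter-like
strategies) is untouched; rung F-Q2-odd instrument; separation NOT moved.
-/

namespace Summit.QuantumAdvantage.AdviceFreeQNC0

open Finset Literature.Computability.MetaComplexity Literature.Computability.MetaComplexity.Hegedus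
open Literature.Computability.MetaComplexity.Smolensky

/-- **`WalkHardFFewReaders p`** (rung R8 ⊋ R7; planner qa-qnc0-p2 g15 Sketch15R7, verbatim): if some adjacent bit pair
`(a, a+1)` is read by at most `(log₂ n)^C` FAR cuts (cuts outside `[a - w, a + 2 + w]`; the exceptional readers form the finset
`S`), the strategy wins on at most `θ·2ⁿ` inputs. -/
def WalkHardFFewReaders (p : ℕ) [Fact p.Prime] : Prop :=
  ∃ θ : ℝ, θ < 1 ∧ ∀ C : ℕ, ∃ n₀ : ℕ, ∀ n ≥ n₀, ∀ c w a : ℕ,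
    w ≤ (Nat.log 2 n) ^ C → a + 2 ≤ n →
    ∀ y : Fin (n + 1) → (Fin n → Bool) → Bool,
      (∀ g, HasDegF p (y g) ((Nat.log 2 n) ^ C)) →
      ∀ S : Finset (Fin (n + 1)), S.card ≤ (Nat.log 2 n) ^ C →
      (∀ g : Fin (n + 1), g ∉ S → (g.val + w < a ∨ a + 2 + w < g.val) →
        ∀ u v : Fin n → Bool, (∀ i : Fin n, i.val ≠ a → i.val ≠ a + 1 → u i = v i) → y g u = y g v) →
      ((Finset.univ.filter fun u : Fin n → Bool => ringWinU c y u = true).card : ℝ) ≤ θ * (2 : ℝ) ^ n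

namespace FewReaders

variable {n : ℕ} {p : ℕ} [Fact p.Prime]

/-! ### Counting: from good block fillings to losing inputs -/

/-- Inputs whose pair fibre contains a losing representative. -/
def good (c a : ℕ) (y : Fin (n + 1) → (Fin n → Bool) → Bool) : Finset (Fin n → Bool) :=
  univ.filter fun u => ringWinU c y (setPair a 0 u) = false ∨ ringWinU c y (setPair a 1 u) = false ∨
    ringWinU c y (setPair a 2 u) = false

/-- Membership in `good` from a losing speed `t < 3`. -/
theorem mem_good {c a : ℕ} {y : Fin (n + 1) → (Fin n → Bool) → Bool} {u : Fin n → Bool} {t : ℕ} (ht : t < 3)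
    (h : ringWinU c y (setPair a t u) = false) : u ∈ good c a y := by
  unfold good
  rw [mem_filter]
  refine ⟨mem_univ _, ?_⟩
  rcases (show t = 0 ∨ t = 1 ∨ t = 2 by omega) with rfl | rfl | rfl
  · exact Or.inl h
  · exact Or.inr (Or.inl h)
  · exact Or.inr (Or.inr h)

/-- The map "input ↦ a losing representative of its pair fibre" is at most `4`-to-`1`, so `|good| ≤ 4·|losers|`. -/
theorem card_good_le {a : ℕ} (ha : a + 1 < n) (c : ℕ) (y : Fin (n + 1) → (Fin n → Bool) → Bool) :
    (good c a y).card ≤ 4 * (univ.filter fun u : Fin n → Bool => ¬ (ringWinU c y u = true)).card := by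
  classical
  -- choose a losing speed
  let tOf : (Fin n → Bool) → ℕ := fun u =>
    if ringWinU c y (setPair a 0 u) = false then 0 else if ringWinU c y (setPair a 1 u) = false then 1 else 2
  have htOf : ∀ u ∈ good c a y, ringWinU c y (setPair a (tOf u) u) = false := by
    intro u hu
    have h := (mem_filter.1 hu).2
    simp only [tOf]
    split_ifs with h0 h1
    · exact h0
    · exact h1
    · rcases h with h | h | h
      · exact absurd h h0
      · exact absurd h h1
      · exact h
  let Φ : (Fin n → Bool) → (Fin n → Bool) := fun u => setPair a (tOf u) u
  -- fibres of `Φ` have at most 4 elements (they agree off the pair)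
  have hfib : ∀ b ∈ (good c a y).image Φ, ((good c a y).filter fun u => Φ u = b).card ≤ 4 := by
    intro b _
    calc ((good c a y).filter fun u => Φ u = b).card
        ≤ (Finset.univ : Finset (Bool × Bool)).card := by
          refine Finset.card_le_card_of_injOn (fun u => (u ⟨a, by omega⟩, u ⟨a + 1, ha⟩)) (fun _ _ => by simp)
            (fun u hu u' hu' huu => ?_)
          rw [Finset.mem_coe, mem_filter] at hu hu'
          simp only [Prod.mk.injEq] at huu
          funext j
          by_cases h₁ : j.val = a
          · have : j = ⟨a, by omega⟩ := Fin.ext h₁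
            rw [this]; exact huu.1
          · by_cases h₂ : j.val = a + 1
            · have : j = ⟨a + 1, ha⟩ := Fin.ext h₂
              rw [this]; exact huu.2
            · have h := congr_fun (hu.2.trans hu'.2.symm) j
              simp only [Φ] at h
              rwa [setPair_of_ne a _ u j h₁ h₂, setPair_of_ne a _ u' j h₁ h₂] at h
      _ = 4 := by simp
  have h1 := Finset.card_le_mul_card_image (good c a y) 4 hfib
  have h2 : ((good c a y).image Φ).card ≤ (univ.filter fun u : Fin n → Bool => ¬ (ringWinU c y u = true)).card := by
    refine Finset.card_le_card fun b hb => ?_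
    obtain ⟨u, hu, rfl⟩ := Finset.mem_image.1 hb
    rw [mem_filter]
    exact ⟨mem_univ _, by rw [htOf u hu]; exact Bool.false_ne_true⟩
  calc (good c a y).card ≤ 4 * ((good c a y).image Φ).card := h1
    _ ≤ 4 * (univ.filter fun u : Fin n → Bool => ¬ (ringWinU c y u = true)).card := Nat.mul_le_mul_left 4 h2

/-- **Core bound for one `n`.**  Block `E = [i, i+L)` avoiding the pair with no special cut strictly inside, non-special cuts
not reading the pair, level-set elimination on the `L`-cube at degree `d ≥ 3|T|·D`: the strategy wins on
`≤ (1 − η₀/4)·2ⁿ` inputs. -/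
theorem card_win_le {η₀ : ℝ} {i L a c d D : ℕ}
    (hElim : ∀ e : (Fin L → Bool) → ℕ,
      (∀ r : ℕ, (fun z => if e z % 3 = r % 3 then (1 : ZMod p) else 0) ∈ lowDeg (ZMod p) L d) →
      η₀ * (2 : ℝ) ^ L ≤ ((univ.filter fun z : Fin L → Bool => e z % 3 = wt z % 3).card : ℝ))
    (hiL : i + L ≤ n) (hE : i + L ≤ a ∨ a + 2 ≤ i) (ha : a + 1 < n)
    (y : Fin (n + 1) → (Fin n → Bool) → Bool) (hy : ∀ g, HasDegF p (y g) D) (T : Finset (Fin (n + 1)))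
    (hT : ∀ g ∈ T, g.val ≤ i ∨ i + L ≤ g.val)
    (hns : ∀ g : Fin (n + 1), g ∉ T → (g.val ≤ a ∨ a + 2 ≤ g.val) ∧ ∀ u u' : Fin n → Bool,
      (∀ j : Fin n, j.val ≠ a → j.val ≠ a + 1 → u j = u' j) → y g u = y g u')
    (hd : 3 * T.card * D ≤ d) :
    ((univ.filter fun u : Fin n → Bool => ringWinU c y u = true).card : ℝ) ≤ (1 - η₀ / 4) * (2 : ℝ) ^ n := by
  classical
  -- (1) every background has `≥ η₀·2^L` good block fillings
  have hgood : ∀ x : Fin n → Bool, η₀ * (2 : ℝ) ^ L ≤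
      ((univ.filter fun z : Fin L → Bool => GapFibre.ow i L x z ∈ good c a y).card : ℝ) := by
    intro x
    have h := hElim (omegaBad y T i L a c x) fun r => lowDeg_mono hd (levelSet_mem_lowDeg y hy T i L a c x r)
    refine h.trans ?_
    have hsub : (univ.filter fun z : Fin L → Bool => omegaBad y T i L a c x z % 3 = wt z % 3) ⊆
        (univ.filter fun z : Fin L → Bool => GapFibre.ow i L x z ∈ good c a y) := by
      intro z hz
      rw [mem_filter] at hz ⊢
      refine ⟨mem_univ _, ?_⟩
      have hω : omegaBad y T i L a c x z = wt z % 3 := by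
        rw [← hz.2]; exact (Nat.mod_eq_of_lt (omegaBad_lt y T i L a c x z)).symm
      obtain ⟨t, ht, hlose⟩ := exists_loss_of_omegaBad_eq hiL hE ha c y T hT hns x z hω
      rw [ow_setPair hE] at hlose
      exact mem_good ht hlose
    exact_mod_cast Finset.card_le_card hsub
  -- (2) fibre double count: `|good| ≥ η₀·2ⁿ`
  have hG : η₀ * (2 : ℝ) ^ n ≤ ((good c a y).card : ℝ) := by
    have hfib := GapFibre.sum_fibre hiL (fun u : Fin n → Bool => if u ∈ good c a y then (1 : ℝ) else 0)
    have hlhs : (∑ u : Fin n → Bool, if u ∈ good c a y then (1 : ℝ) else 0) = ((good c a y).card : ℝ) := by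
      rw [Finset.sum_boole]
      congr 2
      ext u; simp
    have hrhs : ∀ x : Fin n → Bool, η₀ * (2 : ℝ) ^ L ≤
        ∑ z : Fin L → Bool, if GapFibre.ow i L x z ∈ good c a y then (1 : ℝ) else 0 := by
      intro x
      rw [Finset.sum_boole]
      exact_mod_cast hgood x
    have hsum : (Finset.univ : Finset (Fin n → Bool)).card • (η₀ * (2 : ℝ) ^ L) ≤
        ∑ x : Fin n → Bool, ∑ z : Fin L → Bool, if GapFibre.ow i L x z ∈ good c a y then (1 : ℝ) else 0 :=
      Finset.card_nsmul_le_sum _ _ _ fun x _ => hrhs x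
    rw [Finset.card_univ, Fintype.card_fun, Fintype.card_bool, Fintype.card_fin, nsmul_eq_mul, ← hfib, hlhs] at hsum
    push_cast at hsum
    have h2L : (0 : ℝ) < (2 : ℝ) ^ L := by positivity
    nlinarith
  -- (3) losers ≥ |good| / 4, winners = 2ⁿ − losers
  have hGL := card_good_le ha c y
  have htot := Finset.card_filter_add_card_filter_not (s := (Finset.univ : Finset (Fin n → Bool)))
    (fun u : Fin n → Bool => ringWinU c y u = true)
  rw [Finset.card_univ, Fintype.card_fun, Fintype.card_bool, Fintype.card_fin] at htot
  have hW : ((univ.filter fun u : Fin n → Bool => ringWinU c y u = true).card : ℝ) =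
      (2 : ℝ) ^ n - ((univ.filter fun u : Fin n → Bool => ¬ (ringWinU c y u = true)).card : ℝ) := by
    have h := congrArg (fun k : ℕ => (k : ℝ)) htot
    push_cast at h
    linarith
  have hGL' : ((good c a y).card : ℝ) ≤ 4 * ((univ.filter fun u : Fin n → Bool => ¬ (ringWinU c y u = true)).card : ℝ) := by
    exact_mod_cast hGL
  rw [hW]
  nlinarith

/-! ### Asymptotics and the theorem -/

/-- `(log₂ n)^C ≤ c₀ √n` for `n ≥ n₀(C, c₀)` (adapted from `EliminationHardnessF`, where it is private). -/
private theorem logPow_le_sqrt (C : ℕ) {c₀ : ℝ} (hc₀ : 0 < c₀) :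
    ∃ n₀ : ℕ, ∀ n : ℕ, n₀ ≤ n → ((Nat.log 2 n ^ C : ℕ) : ℝ) ≤ c₀ * Real.sqrt n := by
  have hr : (1 : ℝ) < Real.sqrt 2 := by
    rw [show (1 : ℝ) = Real.sqrt 1 by simp]
    exact Real.sqrt_lt_sqrt (by norm_num) (by norm_num)
  have ht := tendsto_pow_const_div_const_pow_of_one_lt C hr
  obtain ⟨K₀, hK₀⟩ := Filter.eventually_atTop.1 (ht.eventually_le_const hc₀)
  refine ⟨2 ^ K₀, fun n hn => ?_⟩
  have hn0 : n ≠ 0 := by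
    have : 0 < 2 ^ K₀ := Nat.pos_of_ne_zero (by positivity)
    omega
  set k := Nat.log 2 n with hk_def
  have hk : K₀ ≤ k := Nat.le_log_of_pow_le one_lt_two hn
  have h2k : (2 : ℝ) ^ k ≤ n := by exact_mod_cast Nat.pow_log_le_self 2 hn0
  have hs_pos : 0 < Real.sqrt 2 ^ k := pow_pos (by positivity) k
  have hsq2 : (Real.sqrt 2 ^ k) ^ 2 = (2 : ℝ) ^ k := by
    rw [← pow_mul, mul_comm, pow_mul, Real.sq_sqrt (by norm_num : (0 : ℝ) ≤ 2)]
  have hle : Real.sqrt 2 ^ k ≤ Real.sqrt n := Real.le_sqrt_of_sq_le (by rw [hsq2]; exact h2k)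
  have hK := hK₀ k hk
  rw [div_le_iff₀ hs_pos] at hK
  push_cast
  calc (k : ℝ) ^ C ≤ c₀ * Real.sqrt 2 ^ k := hK
    _ ≤ c₀ * Real.sqrt n := by gcongr

/-- `√n ≤ n` for naturals. -/
private theorem sqrt_natCast_le (n : ℕ) : Real.sqrt (n : ℝ) ≤ n := by
  rcases Nat.eq_zero_or_pos n with rfl | hn
  · simp
  · have h1 : (1 : ℝ) ≤ n := by exact_mod_cast hn
    have h : Real.sqrt (n : ℝ) ≤ Real.sqrt ((n : ℝ) ^ 2) := Real.sqrt_le_sqrt (by nlinarith)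
    rwa [Real.sqrt_sq (by positivity)] at h

end FewReaders

open FewReaders in
/-- **Rung R8 from level-set elimination** (the `elimLevelSqrtF`-shape hypothesis `hE`): every prime `p`. -/
theorem walkHardFFewReaders_of_elimLevel (p : ℕ) [Fact p.Prime]
    (hE : ∃ η₀ : ℝ, 0 < η₀ ∧ ∃ c₀ : ℝ, 0 < c₀ ∧ ∃ n₀ : ℕ, ∀ n ≥ n₀, ∀ d : ℕ, (d : ℝ) ≤ c₀ * Real.sqrt n →
      ∀ e : (Fin n → Bool) → ℕ,
        (∀ r : ℕ, (fun u => if e u % 3 = r % 3 then (1 : ZMod p) else 0) ∈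
          Smolensky.lowDeg (ZMod p) n d) →
        η₀ * (2 : ℝ) ^ n ≤ ((Finset.univ.filter fun u : Fin n → Bool =>
          e u % 3 = Hegedus.wt u % 3).card : ℝ)) :
    WalkHardFFewReaders p := by
  classical
  obtain ⟨η₀, hη₀, c₀, hc₀, n₁, H⟩ := hE
  refine ⟨1 - η₀ / 4, by linarith, fun C => ?_⟩
  obtain ⟨n₂, hn₂⟩ := logPow_le_sqrt (C * 5) (c₀ := c₀ ^ 2 / 2268) (by positivity)
  obtain ⟨n₃, hn₃⟩ := logPow_le_sqrt C (c₀ := 1 / (7 * ((n₁ : ℝ) + 2))) (by positivity)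
  refine ⟨max 4 (max n₂ n₃), fun n hn c w a hw ha2 y hdeg S hS hloc => ?_⟩
  have hn4 : 4 ≤ n := le_trans (le_max_left _ _) hn
  have hn₂' : n₂ ≤ n := le_trans (le_trans (le_max_left _ _) (le_max_right _ _)) hn
  have hn₃' : n₃ ≤ n := le_trans (le_trans (le_max_right _ _) (le_max_right _ _)) hn
  set Λ := Nat.log 2 n ^ C with hΛ
  have hΛ1 : 1 ≤ Λ := Nat.one_le_pow _ _ (Nat.log_pos one_lt_two (by omega))
  -- the special cuts: readers and near cuts
  let T : Finset (Fin (n + 1)) := S ∪ univ.filter fun g : Fin (n + 1) => ¬ (g.val + w < a ∨ a + 2 + w < g.val)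
  have hnear : (univ.filter fun g : Fin (n + 1) => ¬ (g.val + w < a ∨ a + 2 + w < g.val)).card ≤ 2 * w + 3 := by
    calc (univ.filter fun g : Fin (n + 1) => ¬ (g.val + w < a ∨ a + 2 + w < g.val)).card
        ≤ (Finset.Icc (a - w) (a + 2 + w)).card := by
          refine Finset.card_le_card_of_injOn (fun g => g.val) (fun g hg => ?_) (fun g _ g' _ h => Fin.ext h)
          rw [Finset.mem_coe, mem_filter] at hg
          rw [Finset.mem_coe, Finset.mem_Icc]
          change a - w ≤ g.val ∧ g.val ≤ a + 2 + w
          omega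
      _ ≤ 2 * w + 3 := by rw [Nat.card_Icc]; omega
  have hTcard : T.card ≤ 3 * Λ + 3 :=
    (Finset.card_union_le _ _).trans (by omega)
  have memT : ∀ g : Fin (n + 1), ¬ (g.val + w < a ∨ a + 2 + w < g.val) → g ∈ T := fun g hg =>
    Finset.mem_union_right _ (mem_filter.2 ⟨mem_univ _, hg⟩)
  -- the reader-free block
  obtain ⟨i, L, hfree, hiL, hnL⟩ := CutFreeInterval.exists_free_interval T
  have hA0 := hfree ⟨a, by omega⟩ (memT _ (by simp only; omega))
  have hA1 := hfree ⟨a + 1, by omega⟩ (memT _ (by simp only; omega))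
  have hA2 := hfree ⟨a + 2, by omega⟩ (memT _ (by simp only; omega))
  simp only at hA0 hA1 hA2
  -- `n ≤ 7Λ·L`
  have hnL' : n ≤ 7 * Λ * L := hnL.trans (Nat.mul_le_mul_right L (by omega))
  have hnL'r : (n : ℝ) ≤ 7 * Λ * L := by exact_mod_cast hnL'
  have hΛr : (1 : ℝ) ≤ Λ := by exact_mod_cast hΛ1
  have hsqrt := sqrt_natCast_le n
  -- `L ≥ n₁ + 2`
  have hL : n₁ + 2 ≤ L := by
    have h3 := hn₃ n hn₃'
    rw [← hΛ] at h3
    have h3' : (7 * ((n₁ : ℝ) + 2)) * Λ ≤ n := by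
      have : (Λ : ℝ) ≤ 1 / (7 * ((n₁ : ℝ) + 2)) * n := h3.trans (by gcongr)
      rw [div_mul_eq_mul_div, le_div_iff₀ (by positivity), one_mul] at this
      linarith
    have h4 : (7 * (Λ : ℝ)) * ((n₁ : ℝ) + 2) ≤ (7 * (Λ : ℝ)) * L := by nlinarith
    have h5 : ((n₁ : ℝ) + 2) ≤ L := le_of_mul_le_mul_left h4 (by positivity)
    exact_mod_cast h5
  have hEavoid : i + L ≤ a ∨ a + 2 ≤ i := by omega
  -- the degree budget `3|T|Λ ≤ c₀ √L`
  have hd : ((3 * T.card * Λ : ℕ) : ℝ) ≤ c₀ * Real.sqrt L := by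
    have h2 := hn₂ n hn₂'
    rw [show Nat.log 2 n ^ (C * 5) = Λ ^ 5 from by rw [pow_mul]] at h2
    push_cast at h2
    have h2' : (2268 : ℝ) * (Λ : ℝ) ^ 5 ≤ c₀ ^ 2 * n := by
      have : ((Λ : ℝ)) ^ 5 ≤ c₀ ^ 2 / 2268 * n := h2.trans (by gcongr)
      rw [div_mul_eq_mul_div, le_div_iff₀ (by positivity)] at this
      linarith
    have key : (7 * (Λ : ℝ)) * (324 * (Λ : ℝ) ^ 4) ≤ (7 * (Λ : ℝ)) * (c₀ ^ 2 * L) := by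
      calc (7 * (Λ : ℝ)) * (324 * (Λ : ℝ) ^ 4) = 2268 * (Λ : ℝ) ^ 5 := by ring
        _ ≤ c₀ ^ 2 * n := h2'
        _ ≤ c₀ ^ 2 * (7 * Λ * L) := by gcongr
        _ = (7 * (Λ : ℝ)) * (c₀ ^ 2 * L) := by ring
    have h1 : (324 : ℝ) * (Λ : ℝ) ^ 4 ≤ c₀ ^ 2 * L := le_of_mul_le_mul_left key (by positivity)
    have h3 : (18 : ℝ) * (Λ : ℝ) ^ 2 ≤ c₀ * Real.sqrt L := by
      have h := Real.sqrt_le_sqrt (show ((18 : ℝ) * (Λ : ℝ) ^ 2) ^ 2 ≤ c₀ ^ 2 * L by nlinarith [h1])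
      rwa [Real.sqrt_sq (by positivity), Real.sqrt_mul (sq_nonneg c₀), Real.sqrt_sq hc₀.le] at h
    refine le_trans ?_ h3
    have hT : (T.card : ℝ) ≤ 3 * Λ + 3 := by exact_mod_cast hTcard
    push_cast
    nlinarith
  -- non-special cuts do not read the pair
  have hns : ∀ g : Fin (n + 1), g ∉ T → (g.val ≤ a ∨ a + 2 ≤ g.val) ∧ ∀ u u' : Fin n → Bool,
      (∀ j : Fin n, j.val ≠ a → j.val ≠ a + 1 → u j = u' j) → y g u = y g u' := by
    intro g hg
    have hgS : g ∉ S := fun h => hg (Finset.mem_union_left _ h)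
    have hgfar : g.val + w < a ∨ a + 2 + w < g.val := by
      by_contra h
      exact hg (memT g h)
    exact ⟨by omega, fun u u' huu => hloc g hgS hgfar u u' huu⟩
  exact card_win_le (H L (by omega) (3 * T.card * Λ) hd) hiL hEavoid (by omega) y hdeg T hfree hns le_rfl

/-- **Rung R8 — PROVED for every prime `p ≠ 3`**: few far readers of some adjacent pair ⇒ the strategy wins α's
u-walk game on at most `(1 − η₀/4)·2ⁿ` inputs. -/
theorem walkHardFFewReaders (p : ℕ) [Fact p.Prime] (hp3 : p ≠ 3) : WalkHardFFewReaders p :=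
  walkHardFFewReaders_of_elimLevel p (elimLevelSqrtF p hp3)

end Summit.QuantumAdvantage.AdviceFreeQNC0
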